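import Mathlib
import Literature.RepresentationTheory.FiniteGroups.CharacterDegrees
import Literature.RepresentationTheory.FiniteGroups.IrreducibleCharacters
import Literature.RepresentationTheory.FiniteGroups.InducedClassFunction
import Literature.RepresentationTheory.FiniteGroups.BrauerInduction
import Literature.RepresentationTheory.FiniteGroups.BrauerTheorem
import Literature.RepresentationTheory.FiniteGroups.MonomialRepresentation
import Summits.MatrixMultiplication.MatrixMultiplication.Theorems.SubgroupIdentityDesigns.Negative.LineStabilizer
import Summits.MatrixMultiplication.MatrixMultiplication.Theorems.SubgroupIdentityDesigns.Negative.LineStabilizerCharacter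
import Summits.MatrixMultiplication.MatrixMultiplication.Theorems.SubgroupIdentityDesigns.Negative.BlockSliceBudgetOne

/-!
# The principal-series characters `π_χ = Ind_P^G (χ ∘ a)` of `GL_n(F)`, I: definition, the
# fixed-line formula, degree, and Frobenius reciprocity in fixed-line form

Supports stmt-MatrixMultiplication-14079 (route `LevelGradedCohnUmans`).  VALUE = theorem, NOT summit
progress.  Towards the level-`1` budget of `GL_{1+l}(𝔽_p)` beyond the Steinberg-type character
`Ind_P^G 1 − 1` (`LineStabilizerCharacter`): for a multiplicative character `χ` of `F` let
`a : P → Fˣ` be the eigenvalue of `h ∈ P` on the line `F e_{i₀}` (`ev`, `= h_{i₀ i₀}`) and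
`π_χ := Ind_P^G (χ ∘ a)` (`psChar`).  This file proves

* `psChar_eq_sum` — `π_χ(y) = ∑_{lines L = [g] ∈ G/P} ∑_{b ∈ F} χ(b) · [y (g e_{i₀}) = b (g e_{i₀})]`
  (sum of `χ`-weighted rank-one fibre indicators: this is what makes `π_χ` level `≤ 1` over `𝔽_p`);
* `psChar_one` — `π_χ(1) = [G : P]`;
* `isCharacter_psChar`, and `ev_surjective` (scalar matrices).

Irreducibility for `χ ≠ 1` and pairwise distinctness are in part II (`PrincipalSeriesIrreducible`).
-/

set_option linter.dupNamespace false

noncomputable section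

open scoped BigOperators Matrix Classical
open Literature.RepresentationTheory.FiniteGroups

namespace Summit.MatrixMultiplication.MatrixMultiplication.Theorems.SubgroupIdentityDesigns.Negative
namespace PrincipalSeriesOne

open LineStabilizer LineStabilizerCharacter
open BlockSliceBudgetOne (mulVec_ne_zero)

variable {F : Type} [Field F] [Fintype F] [DecidableEq F] {n : ℕ} (i₀ : Fin n)

local notation "Mat" => Matrix (Fin n) (Fin n) F
local notation "G₀" => GL (Fin n) F
local notation "P₀" => lineStab (F := F) i₀
local notation "Q₀" => GL (Fin n) F ⧸ lineStab (F := F) i₀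
local notation "e₀" => (Pi.single i₀ (1 : F) : Fin n → F)

/-! ## The eigenvalue homomorphism `a : P → Fˣ` -/

omit [Fintype F] [DecidableEq F] in
/-- `(M e_{i₀})_i = M_{i i₀}`. -/
theorem mulVec_single_apply (M : Mat) (i : Fin n) : (M *ᵥ e₀) i = M i i₀ := by
  show (fun j => M i j) ⬝ᵥ e₀ = M i i₀
  rw [dotProduct_single, mul_one]

omit [Fintype F] [DecidableEq F] in
/-- If `M e_{i₀} = a e_{i₀}` then `M_{i₀ i₀} = a`. -/
theorem entry_eq_of_mulVec {M : Mat} {a : F} (h : M *ᵥ e₀ = a • e₀) : M i₀ i₀ = a := by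
  have := congr_fun h i₀
  rw [mulVec_single_apply] at this
  rw [this, Pi.smul_apply, Pi.single_eq_same, smul_eq_mul, mul_one]

omit [Fintype F] [DecidableEq F] in
/-- An eigenvalue of an invertible matrix on a non-zero vector is non-zero. -/
theorem coeff_ne_zero (g : G₀) {v : Fin n → F} {a : F} (hv : v ≠ 0) (h : (g : Mat) *ᵥ v = a • v) :
    a ≠ 0 := by
  rintro rfl
  rw [zero_smul] at h
  exact mulVec_ne_zero g hv h

omit [Fintype F] [DecidableEq F] in
/-- `e_{i₀} ≠ 0`. -/
theorem single_ne_zero : (e₀ : Fin n → F) ≠ 0 := by simp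

/-- **The eigenvalue homomorphism** `a : P → Fˣ`, `h e_{i₀} = a(h) e_{i₀}`; concretely
`a(h) = h_{i₀ i₀}`. -/
def ev : P₀ →* Fˣ where
  toFun h := Units.mk0 (((h : G₀) : Mat) i₀ i₀) (by
    obtain ⟨a, ha⟩ := (mem_lineStab_iff i₀).mp h.2
    rw [entry_eq_of_mulVec i₀ ha]
    exact coeff_ne_zero (h : G₀) (single_ne_zero i₀) ha)
  map_one' := Units.ext (by simp)
  map_mul' h h' := by
    apply Units.ext
    obtain ⟨a, ha⟩ := (mem_lineStab_iff i₀).mp h.2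
    obtain ⟨a', ha'⟩ := (mem_lineStab_iff i₀).mp h'.2
    have hprod : (((h : G₀) : Mat) * ((h' : G₀) : Mat)) *ᵥ e₀ = (a * a') • e₀ := by
      rw [← Matrix.mulVec_mulVec, ha', Matrix.mulVec_smul, ha, smul_smul, mul_comm a' a]
    simp only [Units.val_mk0, Units.val_mul, Subgroup.coe_mul]
    rw [entry_eq_of_mulVec i₀ hprod, entry_eq_of_mulVec i₀ ha, entry_eq_of_mulVec i₀ ha']

omit [Fintype F] [DecidableEq F] in
/-- `a(h)` as an element of `F` is the entry `h_{i₀ i₀}`. -/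
theorem coe_ev (h : P₀) : ((ev i₀ h : Fˣ) : F) = ((h : G₀) : Mat) i₀ i₀ := rfl

omit [Fintype F] [DecidableEq F] in
/-- `h e_{i₀} = a(h) e_{i₀}`. -/
theorem mulVec_eq_ev_smul (h : P₀) : ((h : G₀) : Mat) *ᵥ e₀ = ((ev i₀ h : Fˣ) : F) • e₀ := by
  obtain ⟨a, ha⟩ := (mem_lineStab_iff i₀).mp h.2
  rw [ha, coe_ev, entry_eq_of_mulVec i₀ ha]

omit [Fintype F] [DecidableEq F] in
/-- `a` is surjective (scalar matrices). -/
theorem ev_surjective : Function.Surjective (ev i₀ : P₀ → Fˣ) := by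
  intro c
  obtain ⟨g, hg⟩ := exists_GL_of_linearEquiv (F := F) (n := n) (LinearEquiv.smulOfUnit c)
  have hge : (g : Mat) *ᵥ e₀ = (c : F) • e₀ := by rw [hg]; rfl
  refine ⟨⟨g, ⟨c, hge⟩⟩, Units.ext ?_⟩
  rw [coe_ev]
  exact entry_eq_of_mulVec i₀ hge

/-! ## `π_χ = Ind_P^G (χ ∘ a)` -/

/-- **The principal-series character** `π_χ := Ind_P^G (χ ∘ a)` for a multiplicative character
`χ` of `F` (for `χ = 1` this is the permutation character `θ` on lines). -/
def psChar (χ : MulChar F ℂ) : G₀ → ℂ :=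
  indClassFun (lineStab (F := F) i₀) (fun h => χ ((ev i₀ h : Fˣ) : F))

omit [Fintype F] [DecidableEq F] in
/-- `χ ∘ a` written through the units-valued hom `χ.toUnitHom ∘ a`. -/
theorem coe_comp_eq (χ : MulChar F ℂ) :
    (fun h : P₀ => (((χ.toUnitHom.comp (ev i₀)) h : ℂˣ) : ℂ)) = fun h => χ ((ev i₀ h : Fˣ) : F) :=
  funext fun h => MulChar.coe_toUnitHom χ (ev i₀ h)

omit [Fintype F] [DecidableEq F] in
/-- `χ ∘ a` is a class function on `P`. -/
theorem isClassFun_chi_ev (χ : MulChar F ℂ) : IsClassFun (fun h : P₀ => χ ((ev i₀ h : Fˣ) : F)) := by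
  rw [← coe_comp_eq]
  exact isClassFun_coe_monoidHom (lineStab (F := F) i₀) (χ.toUnitHom.comp (ev i₀))

/-- `π_χ` is a character of `GL_n(F)`. -/
theorem isCharacter_psChar (χ : MulChar F ℂ) : IsCharacter G₀ (psChar i₀ χ) := by
  unfold psChar
  rw [← coe_comp_eq]
  exact isCharacter_indClassFun_monoidHom (lineStab (F := F) i₀) (χ.toUnitHom.comp (ev i₀))

/-- `π_χ` is a class function. -/
theorem isClassFun_psChar (χ : MulChar F ℂ) : IsClassFun (psChar i₀ χ) := by
  unfold psChar
  exact isClassFun_indClassFun _ _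

/-! ## The fixed-line formula -/

/-- A `χ`-weighted sum of line indicators picks out the eigenvalue: if `y v = a v`, `v ≠ 0`, then
`∑_b f(b) [y v = b v] = f(a)`. -/
theorem sum_ite_eq_of_eigen (y : G₀) {v : Fin n → F} (hv : v ≠ 0) {a : F}
    (ha : (y : Mat) *ᵥ v = a • v) (f : F → ℂ) :
    (∑ b : F, f b * (if (y : Mat) *ᵥ v = b • v then 1 else 0)) = f a := by
  rw [Finset.sum_eq_single a]
  · rw [if_pos ha, mul_one]
  · intro b _ hb
    rw [if_neg, mul_zero]
    intro hb'
    have h0 : (b - a) • v = 0 := by rw [sub_smul, ← hb', ← ha, sub_self]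
    exact hb (sub_eq_zero.mp ((smul_eq_zero.mp h0).resolve_right hv))
  · exact fun h => absurd (Finset.mem_univ a) h

/-- … and vanishes if `v` is not an eigenvector of `y`. -/
theorem sum_ite_eq_zero_of_not_eigen (y : G₀) {v : Fin n → F}
    (h : ∀ a : F, (y : Mat) *ᵥ v ≠ a • v) (f : F → ℂ) :
    (∑ b : F, f b * (if (y : Mat) *ᵥ v = b • v then 1 else 0)) = 0 :=
  Finset.sum_eq_zero fun b _ => by rw [if_neg (h b), mul_zero]

omit [Fintype F] [DecidableEq F] in
/-- Conjugation and eigenvectors: `(g⁻¹ y g) e_{i₀} = a e_{i₀} ↔ y (g e_{i₀}) = a (g e_{i₀})`. -/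
theorem conj_mulVec_eq_iff (y g : G₀) (a : F) :
    ((g⁻¹ * y * g : G₀) : Mat) *ᵥ e₀ = a • e₀ ↔
      (y : Mat) *ᵥ ((g : Mat) *ᵥ e₀) = a • ((g : Mat) *ᵥ e₀) := by
  rw [Units.val_mul, Units.val_mul, ← Matrix.mulVec_mulVec, ← Matrix.mulVec_mulVec, mulVec_eq_iff,
    inv_inv, Matrix.mulVec_smul]

/-- **Fixed-line formula**: `π_χ(y) = ∑_{[g] ∈ G/P} ∑_{b ∈ F} χ(b) · [y (g e_{i₀}) = b (g e_{i₀})]`. -/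
theorem psChar_eq_sum (χ : MulChar F ℂ) (y : G₀) :
    psChar i₀ χ y = ∑ q : Q₀, ∑ b : F,
      χ b * (if (y : Mat) *ᵥ (((q.out : G₀) : Mat) *ᵥ e₀) = b • (((q.out : G₀) : Mat) *ᵥ e₀)
        then 1 else 0) := by
  unfold psChar
  rw [indClassFun_eq_sum_quotient _ (isClassFun_chi_ev i₀ χ)]
  refine Finset.sum_congr rfl fun q _ => ?_
  have hv : ((q.out : G₀) : Mat) *ᵥ e₀ ≠ 0 := mulVec_ne_zero q.out (single_ne_zero i₀)
  by_cases hmem : q.out⁻¹ * y * q.out ∈ P₀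
  · rw [extend_subtypeVal_apply _ _ ⟨_, hmem⟩]
    obtain ⟨a, ha⟩ := (mem_lineStab_iff i₀).mp hmem
    have ha' : (y : Mat) *ᵥ (((q.out : G₀) : Mat) *ᵥ e₀) = a • (((q.out : G₀) : Mat) *ᵥ e₀) :=
      (conj_mulVec_eq_iff i₀ y q.out a).mp ha
    rw [sum_ite_eq_of_eigen y hv ha', coe_ev]
    exact congrArg χ (entry_eq_of_mulVec i₀ ha)
  · rw [extend_subtypeVal_of_not_mem _ _ hmem]
    exact (sum_ite_eq_zero_of_not_eigen y
      (fun a ha => hmem ⟨a, (conj_mulVec_eq_iff i₀ y q.out a).mpr ha⟩) _).symm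

/-- **Degree**: `π_χ(1) = [G : P]`. -/
theorem psChar_one (χ : MulChar F ℂ) : psChar i₀ χ 1 = (Fintype.card Q₀ : ℂ) := by
  rw [psChar_eq_sum]
  have h : ∀ q : Q₀, (∑ b : F, χ b *
      (if ((1 : G₀) : Mat) *ᵥ (((q.out : G₀) : Mat) *ᵥ e₀) = b • (((q.out : G₀) : Mat) *ᵥ e₀)
        then 1 else 0)) = 1 := fun q => by
    rw [sum_ite_eq_of_eigen 1 (mulVec_ne_zero q.out (single_ne_zero i₀)) (a := 1)
      (by rw [Units.val_one, Matrix.one_mulVec, one_smul]), map_one]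
  rw [Finset.sum_congr rfl fun q _ => h q, Finset.sum_const, Finset.card_univ, nsmul_eq_mul, mul_one]

/-! ## Frobenius reciprocity in fixed-line form -/

omit [Fintype F] [DecidableEq F] in
/-- The `P`-stabiliser of a coset `[g]` is the set of `h ∈ P` having `g e_{i₀}` as an eigenvector. -/
theorem smul_eq_iff_eigen (h : P₀) (q : Q₀) :
    h • q = q ↔ ∃ b : F, ((h : G₀) : Mat) *ᵥ (((q.out : G₀) : Mat) *ᵥ e₀) =
      b • (((q.out : G₀) : Mat) *ᵥ e₀) := by
  rw [show (h • q = q) = ((h : G₀) • q = q) from rfl, smul_eq_self_iff_mem _ (h : G₀) q]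
  exact (mem_lineStab_iff i₀).trans (exists_congr fun b => conj_mulVec_eq_iff i₀ (h : G₀) q.out b)

/-- **`|P| · ⟨π_χ, π_χ'⟩ = ∑_{h ∈ P} χ(a(h))⁻¹ · π_χ'(h)`** (Frobenius reciprocity
`⟨Ind λ, φ⟩_G = ⟨λ, Res φ⟩_P`, summed over `h ↦ h⁻¹`). -/
theorem card_mul_classInner (χ χ' : MulChar F ℂ) :
    (Fintype.card P₀ : ℂ) * classInner (psChar i₀ χ) (psChar i₀ χ') =
      ∑ h : P₀, (χ ((ev i₀ h : Fˣ) : F))⁻¹ * psChar i₀ χ' (h : G₀) := by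
  have hP : (Fintype.card P₀ : ℂ) ≠ 0 := Nat.cast_ne_zero.mpr Fintype.card_ne_zero
  conv_lhs => rw [psChar, classInner_indClassFun_left _ _ (isClassFun_psChar i₀ χ'), classInner_apply]
  rw [← mul_assoc, mul_inv_cancel₀ hP, one_mul]
  refine Fintype.sum_equiv (Equiv.inv P₀) _ _ fun s => ?_
  simp only [Equiv.inv_apply]
  congr 1
  rw [map_inv, ← MulChar.coe_toUnitHom χ (ev i₀ s)⁻¹, map_inv, Units.val_inv_eq_inv_val, inv_inv,
    MulChar.coe_toUnitHom]

end PrincipalSeriesOne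
end Summit.MatrixMultiplication.MatrixMultiplication.Theorems.SubgroupIdentityDesigns.Negative
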